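import Mathlib
import HarnessLib

/-!
# Fibred Born–Oppenheimer blocks — part 4: the Gaussian kinetic kernel is a GRAM kernel (Gaussian semigroup), so weighted Gaussian transfer
# kernels `m_c(q)·e^{−b‖q−q'‖²}·m_{c'}(q')` are fibred kernels in the sense of `…FibredBOBlocks/…FibredBOKernel`
# (route `FlatTubeReduction`, crux K1 `NearFlatRatioLaw` stmt-QuantumFields-24720, registered stub `stub_boRate` = FCL 23943's `BORateAll`;
# rung R2b1 = RECORD-label femto gap; no summit statement is proved here)

Seat `ym-line-ftr-p1` g6 (prover).  The c-FROZEN stiff model of the rate twin (FCL `Cruxes/FixedLatticeLaw/Lines/rate.md` APPENDIX v4, B3: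
`k_b(x,x') = e^{−⟪x,A_ux⟫}e^{−b‖x−x'‖²}e^{−⟪x',A_ux'⟫}`; route RED lane A's tensor model is the `u`-independent case) and, more generally, ANY symmetric
weighted Gaussian transfer kernel `m_c(q)·e^{−b‖q−q'‖²}·m_{c'}(q')` on a finite-dimensional real inner-product space `V` (Lebesgue measure) — with the
EXACT (anharmonic) fibre Boltzmann weight `m_c` if one wishes — is a fibred kernel with half-kernel `s(c,q,z) = m_c(q)·e^{−2b‖q−z‖²}`, because the
Gaussian is its own convolution square root:
* `two_mul_norm_sub_sq_add` — midpoint completion of the square `2b‖q−z‖² + 2b‖q'−z‖² = 4b‖z − ½(q+q')‖² + b‖q−q'‖²`;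
* ★ `integral_gaussHalf_mul_gaussHalf` — the GAUSSIAN SEMIGROUP identity `∫ e^{−2b‖q−z‖²}e^{−2b‖q'−z‖²} dz = (π/4b)^{n/2}·e^{−b‖q−q'‖²}` (`n = dim V`);
* ★★ `integral_weightedGaussHalf_mul` — `∫ (m_c(q)e^{−2b‖q−z‖²})·(m_{c'}(q')e^{−2b‖q'−z‖²}) dz = (π/4b)^{n/2}·m_c(q)·e^{−b‖q−q'‖²}·m_{c'}(q')`, i.e. the
  Gram kernel `gramKernel volume s` of `…FibredBOKernel` for this `s` IS the weighted Gaussian transfer kernel (up to the explicit constant), so the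
  MASTER / DIAG / STIFF / CROSS blocks and the odd/even split (`…KernelParity`, `ι : q ↦ −q`) apply to it verbatim.
HONEST FRAMING: a Gaussian integral; the chart that makes the lattice transfer operator such a kernel (plus controlled errors) is OPEN (route RED lane A
C4-CORE + the rate twin, `Cruxes/NearFlatRatioLaw/Lines/borate.md`); nothing here is infinite volume, a continuum limit or the Clay mass gap.  No definitions,
no named facts, no `sorry`.

## References
* A. Wipf, *Statistical Approach to Quantum Field Theory*, LNP 992, Springer 2021, §8.5.1 (Gaussian transfer kernels) — [cite: Wipf2021, §8.5.1 (8.54)–(8.56)].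
* B. Helffer, *Spectral Theory and its Applications*, CUP 2013, §7.1 — [cite: Helffer2013, §7.1 pp.77–78].
-/

set_option autoImplicit false

noncomputable section

open MeasureTheory Real
open scoped RealInnerProductSpace

namespace Summit.QuantumFields.YangMills.Theorems.FemtoTransferGap.FibredBO

variable {V : Type*} [NormedAddCommGroup V] [InnerProductSpace ℝ V] [FiniteDimensional ℝ V] [MeasurableSpace V] [BorelSpace V]

omit [FiniteDimensional ℝ V] [MeasurableSpace V] [BorelSpace V] in
/-- Midpoint completion of the square: `2b‖q−z‖² + 2b‖q'−z‖² = 4b‖z − ½(q+q')‖² + b‖q−q'‖²` (parallelogram law). [folklore] -/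
theorem two_mul_norm_sub_sq_add (b : ℝ) (q q' z : V) :
    2 * b * ‖q - z‖ ^ 2 + 2 * b * ‖q' - z‖ ^ 2 = 4 * b * ‖z - (1 / 2 : ℝ) • (q + q')‖ ^ 2 + b * ‖q - q'‖ ^ 2 := by
  have h1 : ‖q - z‖ ^ 2 = ‖q‖ ^ 2 - 2 * ⟪q, z⟫ + ‖z‖ ^ 2 := norm_sub_sq_real q z
  have h2 : ‖q' - z‖ ^ 2 = ‖q'‖ ^ 2 - 2 * ⟪q', z⟫ + ‖z‖ ^ 2 := norm_sub_sq_real q' z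
  have h3 : ‖q - q'‖ ^ 2 = ‖q‖ ^ 2 - 2 * ⟪q, q'⟫ + ‖q'‖ ^ 2 := norm_sub_sq_real q q'
  have h4 : ‖z - (1 / 2 : ℝ) • (q + q')‖ ^ 2 = ‖z‖ ^ 2 - 2 * ⟪z, (1 / 2 : ℝ) • (q + q')⟫ + ‖(1 / 2 : ℝ) • (q + q')‖ ^ 2 :=
    norm_sub_sq_real z _
  have h5 : ⟪z, (1 / 2 : ℝ) • (q + q')⟫ = (1 / 2 : ℝ) * (⟪q, z⟫ + ⟪q', z⟫) := by
    rw [inner_smul_right, inner_add_right, real_inner_comm z q, real_inner_comm z q']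
  have h6 : ‖(1 / 2 : ℝ) • (q + q')‖ ^ 2 = (1 / 2 : ℝ) ^ 2 * (‖q‖ ^ 2 + 2 * ⟪q, q'⟫ + ‖q'‖ ^ 2) := by
    rw [norm_smul, mul_pow, Real.norm_eq_abs, sq_abs, norm_add_sq_real]
  rw [h1, h2, h3, h4, h5, h6]
  ring

/-- ★ **Gaussian semigroup**: `∫ e^{−2b‖q−z‖²}·e^{−2b‖q'−z‖²} dz = (π/(4b))^{n/2}·e^{−b‖q−q'‖²}` (`n = dim V`, Lebesgue measure, `b > 0`).
[cite: Wipf2021, §8.5.1 (8.54)–(8.56)] -/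
theorem integral_gaussHalf_mul_gaussHalf {b : ℝ} (hb : 0 < b) (q q' : V) :
    ∫ z, Real.exp (-(2 * b * ‖q - z‖ ^ 2)) * Real.exp (-(2 * b * ‖q' - z‖ ^ 2)) =
      (π / (4 * b)) ^ ((Module.finrank ℝ V : ℝ) / 2) * Real.exp (-(b * ‖q - q'‖ ^ 2)) := by
  have e : ∀ z : V, Real.exp (-(2 * b * ‖q - z‖ ^ 2)) * Real.exp (-(2 * b * ‖q' - z‖ ^ 2)) =
      Real.exp (-(b * ‖q - q'‖ ^ 2)) * Real.exp (-((4 * b) * ‖z - (1 / 2 : ℝ) • (q + q')‖ ^ 2)) := by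
    intro z
    rw [← Real.exp_add, ← Real.exp_add]
    congr 1
    linarith [two_mul_norm_sub_sq_add b q q' z]
  simp_rw [e]
  rw [integral_const_mul]
  have ht := integral_sub_right_eq_self (μ := (volume : Measure V)) (fun z : V => Real.exp (-((4 * b) * ‖z‖ ^ 2))) ((1 / 2 : ℝ) • (q + q'))
  rw [ht]
  have hg := GaussianFourier.integral_rexp_neg_mul_sq_norm (V := V) (show 0 < 4 * b by positivity)
  simp only [neg_mul] at hg
  rw [hg, mul_comm]

/-- ★★ **Weighted Gaussian transfer kernels are Gram kernels**: for ANY fibre weights `m, m'` (e.g. `m = e^{−⟪q,A_c q⟫}` of the c-frozen stiff model, or the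
exact fibre Boltzmann weight) `∫ (m(q)e^{−2b‖q−z‖²})·(m'(q')e^{−2b‖q'−z‖²}) dz = (π/(4b))^{n/2}·m(q)·e^{−b‖q−q'‖²}·m'(q')` — with `s(c,q,z) := m_c(q)·e^{−2b‖q−z‖²}`
this is the Gram kernel `gramKernel volume s c c' q q'` of `…FibredBOKernel`, i.e. the kernel `k(c,c')·m_c(q)e^{−b‖q−q'‖²}m_{c'}(q')` is a fibred kernel.
[cite: Wipf2021, §8.5.1 (8.54)–(8.56)] [cite: Helffer2013, §7.1 pp.77–78] -/
theorem integral_weightedGaussHalf_mul {b : ℝ} (hb : 0 < b) (m m' : V → ℝ) (q q' : V) :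
    ∫ z, (m q * Real.exp (-(2 * b * ‖q - z‖ ^ 2))) * (m' q' * Real.exp (-(2 * b * ‖q' - z‖ ^ 2))) =
      (π / (4 * b)) ^ ((Module.finrank ℝ V : ℝ) / 2) * (m q * Real.exp (-(b * ‖q - q'‖ ^ 2)) * m' q') := by
  have e : ∀ z : V, (m q * Real.exp (-(2 * b * ‖q - z‖ ^ 2))) * (m' q' * Real.exp (-(2 * b * ‖q' - z‖ ^ 2))) =
      (m q * m' q') * (Real.exp (-(2 * b * ‖q - z‖ ^ 2)) * Real.exp (-(2 * b * ‖q' - z‖ ^ 2))) := fun z => by ring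
  simp_rw [e]
  rw [integral_const_mul, integral_gaussHalf_mul_gaussHalf hb]
  ring

end Summit.QuantumFields.YangMills.Theorems.FemtoTransferGap.FibredBO

end
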